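import Summits.QuantumFields.YangMills.Theorems.BalabanUVNodesN15TwoGridCellMean
import HarnessLib

/-!
# N15 (NE2) — PROGRAMME M-III «LEVEL CURRENCY FOR THE MIXED ROW», part III-A: ★★★ THE LEVEL SPLIT — the sandwiched zeroth-order coefficient defect `T′∘𝔇(M_{c′}, M_{c̄})` for a
# front operator given LEVEL BY LEVEL: the long-range levels integrated by parts (M-B: one rate factor `L^{−k}` against the source-divergence row), the short-range levels NOT (the
# plain row, which already carries its own geometric factor) — the mechanism that makes `T′ := ∇′G′` admissible WITHOUT the `ℓ^∞`-divergent row of «∇G∇*»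

WHO ∕ WHEN.  Cell `pub-ymgap`, seat `pub-ymgap-dag-n15-a` (KNIT-BY-NAME seat of Track-A DAG node N15 = NE2, g24); `--kind proof --supports stmt-QuantumFields-27366 --as helper` (K3⁸;
count-neutral).  THEOREMS ONLY (0 `def`).  Over M-B `…TwoGridMeanZeroMultiplier` (`hasMaj_mulOp_comp_pull`, ★★★ `hasMaj_comp_mulOp_sub_cellSweep_pull`, `abs_sub_cellSweep_le`, `sum_mul_diagK_const`)
and M-C `…TwoGridCellMean` (`cellSweep_eq_pull_blockAvg`, `idef_mulOp_eq`), part 3 `hasMaj_finsum` BY NAME; nothing in the tree is modified.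

WHY (the located obstruction of M-II, and dag-n15-d g20's ARCHITECTURE NOTE I.41910 with this seat's reply I.≈41925).  M-C bounds `T′∘𝔇(M_{c′}, M_{blockAvg c′})` by
`2(d+1)·r·L^{−k}·K` from the source-DIVERGENCE rows `T′∘∇′*_κ ≤ K`.  At `T′ := ∇′_νG′` — the front operator of the gradient entry of a dressed pair — that row is the mixed row «∇G∇*»,
whose `ℓ^∞` block norm carries the near-field logarithm `log n′ = (m+k)·log L`: NOT uniform in the refinement `m`.  THE CURE: a multiscale front operator `T′ = Σ_i T_i` (King ∕ Bałaban
propagators ARE such sums) is split at the cell scale — for the levels whose range exceeds a cell (`i < k₀`) one integrates by parts (M-B) and pays `L^{−k}·(row of T_i∇′*)` = `L^{−k}·O(1)`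
per level; for the levels of range below a cell (`k₀ ≤ i`) one does NOT, and pays the plain row of `T_i`, geometrically small (`O(L^{−i})`) by itself.  Net: `O(L^{−k}·(k₀ + const))` —
the logarithm counts COARSE levels only, uniform in `m`, and rides on the rate `(L^k)^{−γ}`.

WHAT ([folklore] bookkeeping; 0 def).  §24 `hasMaj_comp_mulOp_pull_crude` (one short-range level: `T∘M_g∘P ≤ ω·a` from the plain row `T ≤ a`, `|g| ≤ ω`), ★★★ `hasMaj_levels_comp_mulOp_sub_cellSweep_pull`
(any finite family `T_i`, any decidable split `byParts`: `(Σ_i T_i)∘M_{w − cellSweep w}∘P ≤ Σ_i [byParts i ? 2(d+1)ωL^{−k}·b_i : 2ω·a_i]`), ★★★ `hasMaj_levels_comp_idef_mulOp_blockAvg` (the same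
for `(Σ_i T_i)∘𝔇(M_{c′}, M_{blockAvg c′})` — M-C's ★★★ with the operator-row hypothesis REPLACED by per-level letters and a split).  §25 the geometric bookkeeping:
`geomLevels_sum_le` and ★★ `hasMaj_levels_comp_idef_mulOp_blockAvg_geom` — plain rows `a_i = α·θ^i·e^{−δd}` (`0 ≤ θ < 1`) on the levels `k₀ ≤ i < K′`, divergence rows `b_i = β·e^{−δd}` on
`i < k₀`: `(Σ_i T_i)∘𝔇(M_{c′}, M_{c̄}) ≤ 2(d+1)·r·(L^{−k}·β·k₀ + α·θ^{k₀}∕(1−θ))·e^{−δd}` — at `θ = L⁻¹`, `k₀ = k + 1`: `2(d+1)r·L^{−k}·(β(k+1) + αL∕(L−1)∕L)·e^{−δd}`, UNIFORM IN `K′ ⊇` the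
refinement.
CONSUMERS.  dag-n15-d∕-e's King-model rung (per-slice rows of `∇G_K` and `∇G_K∇*` from `ksSlice_decay_unif` ∕ `ksDSlice_decay_unif` + `tdistT_sumBound`) for the GRADIENT entry of the dressed
pairs via the jet linear system (their (o5a)); Bałaban's `gOp` once a level decomposition with per-level rows is typed (located, (S3) of I.≈41925).

HONEST FRAMING ∕ LIMITS.  Block-majorant bookkeeping over hypothesis-shaped per-level rows; no estimate of [B5]∕[B6]∕[B9]∕[King1986] asserted; NE2⁺ NOT printed ∕ proved; no statement of record
touched; N15 NOT discharged; K3⁸ OPEN; counts UNMOVED (typed 28∕28 · discharged 5∕27); NOT infinite volume ∕ OS ∕ mass gap ∕ Clay.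
-/

noncomputable section

open scoped BigOperators
open Finset

namespace Summit.QuantumFields.YangMills.BalabanUVNodes.N15.TwoGrid

open Literature.MathematicalPhysics.QuantumFieldTheory.Balaban1983to89
open Literature.MathematicalPhysics.QuantumFieldTheory.Balaban1983to89.B11SectG (BlockNorm HasMaj hasMaj_comp)
open Literature.MathematicalPhysics.QuantumFieldTheory.Balaban1983to89.T4EtaRateDefect (idef)
open Literature.MathematicalPhysics.QuantumFieldTheory.Balaban1983to89.T4EtaRateCoeffDefect (pull pull_apply diagK blockAvg idef_mulOp_eq)
open Literature.MathematicalPhysics.QuantumFieldTheory.Balaban1983to89.B6Prop26Gluing (mulOp mulOp_apply)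
open Literature.MathematicalPhysics.QuantumFieldTheory.Balaban1983to89.B5Prop11Plancherel (Tor fine unitVec)
open Literature.MathematicalPhysics.QuantumFieldTheory.King1986.Torus (blockOf tdistT tdistT_nonneg)
open Literature.MathematicalPhysics.QuantumFieldTheory.Balaban1983to89.B6UnitTorusCarrier (unitTorusGeo)
open Summit.QuantumFields.YangMills.BalabanUVNodes.N15.VectorPiece (blkFine kingPrV)
open Summit.QuantumFields.YangMills.BalabanUVNodes.N15.BackgroundModel (kappa_ofBlocks)

variable {d : ℕ}

/-! ## §24 The level split -/

section Levels

variable {L : ℕ} [NeZero L] (M : Fin (d + 1) → ℕ) [∀ μ, NeZero (M μ)] (k m : ℕ) {F₂ : Type} [AddCommGroup F₂] [Module ℝ F₂]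

/-- ONE SHORT-RANGE LEVEL, NO INTEGRATION BY PARTS: `T∘M_g∘P ≤ ω·a` from the plain row `T ≤ a` (`a ≥ 0`) and `|g| ≤ ω`. [folklore] -/
theorem hasMaj_comp_mulOp_pull_crude {b₂ : BlockNorm (unitTorusGeo L k M) F₂} {T : (Tor (fine (L ^ m * L ^ k) M) × Fin (d + 1) → ℝ) →ₗ[ℝ] F₂} {a : Tor M → Tor M → ℝ}
    (ha : ∀ y y', 0 ≤ a y y') {g : Tor (fine (L ^ m * L ^ k) M) × Fin (d + 1) → ℝ} {ω : ℝ} (hω : 0 ≤ ω) (hg : ∀ z, |g z| ≤ ω)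
    (hT : HasMaj (BlockNorm.ofBlocks (unitTorusGeo L k M) (fun i : Tor (fine (L ^ m * L ^ k) M) × Fin (d + 1) => blockOf (L ^ m * L ^ k) M i.1)) b₂ T a) :
    HasMaj (BlockNorm.ofBlocks (unitTorusGeo L k M) (blkFine L k M)) b₂ (T ∘ₗ (mulOp g ∘ₗ pull (kingPrV L k m M))) (fun y y' => ω * a y y') := by
  have key := hasMaj_comp hT (hasMaj_mulOp_comp_pull M k m hω hg) ha
  refine key.mono fun y y' => le_of_eq ?_
  rw [kappa_ofBlocks]
  simp only [one_mul]
  rw [sum_mul_diagK_const]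
  ring

/-- ★★★ **THE LEVEL SPLIT FOR THE MEAN-ZERO MULTIPLIER BEHIND THE PROLONGATION.**  A finite family of fine operators `T_i` (`i ∈ s`), a decidable split `byParts`; for the levels with
`byParts i` the source-DIVERGENCE rows `T_i∘ρ′(n′(s_κ⁻¹ − 1)) ≤ b_i` (all `κ`), for the others the PLAIN rows `T_i ≤ a_i` (`a_i, b_i ≥ 0`); `|w| ≤ ω`.  Then
`(Σ_i T_i)∘M_{w − cellSweep_{d+1}w}∘P ≤ Σ_i [byParts i ? 2(d+1)·ω·L^{−k}·b_i : 2ω·a_i]` — M-B's ★★★ level by level where it gains, the plain row where it does not.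
[cite: Balaban1985BackgroundPropagators, (3.35) p.396 (sup letter only); King1986, p.664 (pairing), (4.42) p.670 (the propagator as a sum over levels: shape)] -/
theorem hasMaj_levels_comp_mulOp_sub_cellSweep_pull {ι : Type} (s : Finset ι) (byParts : ι → Prop) [DecidablePred byParts] {b₂ : BlockNorm (unitTorusGeo L k M) F₂}
    {T : ι → (Tor (fine (L ^ m * L ^ k) M) × Fin (d + 1) → ℝ) →ₗ[ℝ] F₂} {a b : ι → Tor M → Tor M → ℝ} (ha : ∀ i y y', 0 ≤ a i y y') (hb : ∀ i y y', 0 ≤ b i y y')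
    (hTa : ∀ i ∈ s, ¬ byParts i →
      HasMaj (BlockNorm.ofBlocks (unitTorusGeo L k M) (fun i : Tor (fine (L ^ m * L ^ k) M) × Fin (d + 1) => blockOf (L ^ m * L ^ k) M i.1)) b₂ (T i) (a i))
    (hTb : ∀ i ∈ s, byParts i → ∀ κ : Fin (d + 1),
      HasMaj (BlockNorm.ofBlocks (unitTorusGeo L k M) (fun i : Tor (fine (L ^ m * L ^ k) M) × Fin (d + 1) => blockOf (L ^ m * L ^ k) M i.1)) b₂
        (T i ∘ₗ symbOp M (L ^ m * L ^ k) (((L ^ m * L ^ k : ℕ) : ℝ) • (sTinv M (L ^ m * L ^ k) κ - 1))) (b i))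
    {w : Tor (fine (L ^ m * L ^ k) M) × Fin (d + 1) → ℝ} {ω : ℝ} (hω : 0 ≤ ω) (hw : ∀ z, |w z| ≤ ω) :
    HasMaj (BlockNorm.ofBlocks (unitTorusGeo L k M) (blkFine L k M)) b₂
      ((∑ i ∈ s, T i) ∘ₗ (mulOp (w - cellSweep M (L ^ m * L ^ k) (L ^ m) (d + 1) w) ∘ₗ pull (kingPrV L k m M)))
      (fun y y' => ∑ i ∈ s, if byParts i then 2 * (d + 1) * ω * (((L ^ k : ℕ) : ℝ))⁻¹ * b i y y' else 2 * ω * a i y y') := by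
  have hℓ : 0 < L ^ m := pow_pos (Nat.pos_of_ne_zero (NeZero.ne L)) m
  have hop : (∑ i ∈ s, T i) ∘ₗ (mulOp (w - cellSweep M (L ^ m * L ^ k) (L ^ m) (d + 1) w) ∘ₗ pull (kingPrV L k m M)) =
      ∑ i ∈ s, T i ∘ₗ (mulOp (w - cellSweep M (L ^ m * L ^ k) (L ^ m) (d + 1) w) ∘ₗ pull (kingPrV L k m M)) := by
    refine LinearMap.ext fun f => ?_
    simp only [LinearMap.comp_apply, LinearMap.sum_apply]
  rw [hop]
  refine hasMaj_finsum (b₁ := BlockNorm.ofBlocks (unitTorusGeo L k M) (blkFine L k M)) (b₂ := b₂) s _ _ fun i hi => ?_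
  by_cases hbp : byParts i
  · simp only [if_pos hbp]
    exact hasMaj_comp_mulOp_sub_cellSweep_pull M k m (hb i) hω hw (hTb i hi hbp)
  · simp only [if_neg hbp]
    have h := hasMaj_comp_mulOp_pull_crude M k m (ha i) (by positivity : (0 : ℝ) ≤ 2 * ω)
      (fun z => abs_sub_cellSweep_le M (L ^ m * L ^ k) hℓ hw (d + 1) z) (hTa i hi hbp)
    exact h.mono fun y y' => le_of_eq (by ring)

/-- ★★★ **THE SANDWICHED ZEROTH-ORDER COEFFICIENT DEFECT FOR A FRONT OPERATOR GIVEN LEVEL BY LEVEL**: `(Σ_i T_i)∘𝔇(M_{c′}, M_{blockAvg c′}) ≤ Σ_i [byParts i ? 2(d+1)·r·L^{−k}·b_i : 2r·a_i]`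
from `|c′| ≤ r` and the per-level rows — M-C's ★★★ with the source-divergence hypothesis demanded ONLY of the levels one chooses to integrate by parts.
[cite: Balaban1985BackgroundPropagators, (3.35) p.396 (sup letter only), (3.62)–(3.65) pp.402–403 (mechanism); King1986, p.664, (4.42) p.670 (shapes)] -/
theorem hasMaj_levels_comp_idef_mulOp_blockAvg {ι : Type} (s : Finset ι) (byParts : ι → Prop) [DecidablePred byParts] {b₂ : BlockNorm (unitTorusGeo L k M) F₂}
    {T : ι → (Tor (fine (L ^ m * L ^ k) M) × Fin (d + 1) → ℝ) →ₗ[ℝ] F₂} {a b : ι → Tor M → Tor M → ℝ} (ha : ∀ i y y', 0 ≤ a i y y') (hb : ∀ i y y', 0 ≤ b i y y')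
    (hTa : ∀ i ∈ s, ¬ byParts i →
      HasMaj (BlockNorm.ofBlocks (unitTorusGeo L k M) (fun i : Tor (fine (L ^ m * L ^ k) M) × Fin (d + 1) => blockOf (L ^ m * L ^ k) M i.1)) b₂ (T i) (a i))
    (hTb : ∀ i ∈ s, byParts i → ∀ κ : Fin (d + 1),
      HasMaj (BlockNorm.ofBlocks (unitTorusGeo L k M) (fun i : Tor (fine (L ^ m * L ^ k) M) × Fin (d + 1) => blockOf (L ^ m * L ^ k) M i.1)) b₂
        (T i ∘ₗ symbOp M (L ^ m * L ^ k) (((L ^ m * L ^ k : ℕ) : ℝ) • (sTinv M (L ^ m * L ^ k) κ - 1))) (b i))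
    {c' : Tor (fine (L ^ m * L ^ k) M) × Fin (d + 1) → ℝ} {r : ℝ} (hr : 0 ≤ r) (hc' : ∀ z, |c' z| ≤ r) :
    HasMaj (BlockNorm.ofBlocks (unitTorusGeo L k M) (blkFine L k M)) b₂
      ((∑ i ∈ s, T i) ∘ₗ idef (pull (kingPrV L k m M)) (pull (kingPrV L k m M)) (mulOp c') (mulOp (blockAvg (kingPrV L k m M) c')))
      (fun y y' => ∑ i ∈ s, if byParts i then 2 * (d + 1) * r * (((L ^ k : ℕ) : ℝ))⁻¹ * b i y y' else 2 * r * a i y y') := by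
  have hid : idef (pull (kingPrV L k m M)) (pull (kingPrV L k m M)) (mulOp c') (mulOp (blockAvg (kingPrV L k m M) c')) =
      mulOp (c' - cellSweep M (L ^ m * L ^ k) (L ^ m) (d + 1) c') ∘ₗ pull (kingPrV L k m M) := by
    rw [idef_mulOp_eq, cellSweep_eq_pull_blockAvg]
    rfl
  rw [hid]
  exact hasMaj_levels_comp_mulOp_sub_cellSweep_pull M k m s byParts ha hb hTa hTb hr hc'

end Levels

/-! ## §25 The geometric bookkeeping: plain rows `α·θ^i` on the short-range levels, divergence rows `β` on the `k₀` long-range ones -/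

/-- the two partial sums: `Σ_{i<K′} [i < k₀ ? p·β : q·α·θ^i] ≤ p·β·k₀ + q·α·θ^{k₀}∕(1 − θ)` for `0 ≤ θ < 1` and non-negative `p, q, α, β`. [folklore] -/
theorem geomLevels_sum_le {K' k₀ : ℕ} {p q α β θ : ℝ} (hp : 0 ≤ p) (hq : 0 ≤ q) (hα : 0 ≤ α) (hβ : 0 ≤ β) (hθ0 : 0 ≤ θ) (hθ1 : θ < 1) :
    ∑ i ∈ range K', (if i < k₀ then p * β else q * (α * θ ^ i)) ≤ p * β * k₀ + q * α * (θ ^ k₀ / (1 - θ)) := by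
  have h1 : ∑ i ∈ range K', (if i < k₀ then p * β else q * (α * θ ^ i)) ≤
      ∑ i ∈ range K', ((if i < k₀ then p * β else 0) + (if k₀ ≤ i then q * (α * θ ^ i) else 0)) := by
    refine sum_le_sum fun i _ => ?_
    by_cases h : i < k₀
    · rw [if_pos h, if_pos h, if_neg (not_le.mpr h), add_zero]
    · rw [if_neg h, if_neg h, if_pos (not_lt.mp h), zero_add]
  have h2 : ∑ i ∈ range K', (if i < k₀ then p * β else 0) ≤ p * β * k₀ := by
    calc ∑ i ∈ range K', (if i < k₀ then p * β else (0 : ℝ)) ≤ ∑ i ∈ range k₀, p * β := by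
          rw [← sum_filter]
          refine (sum_le_sum_of_subset_of_nonneg (fun i hi => ?_) fun _ _ _ => mul_nonneg hp hβ)
          simp only [mem_filter, mem_range] at hi ⊢
          exact hi.2
      _ = p * β * k₀ := by rw [sum_const, card_range, nsmul_eq_mul]; ring
  have h3 : ∑ i ∈ range K', (if k₀ ≤ i then q * (α * θ ^ i) else 0) ≤ q * α * (θ ^ k₀ / (1 - θ)) := by
    have hgeom : ∀ n : ℕ, ∑ j ∈ range n, θ ^ j ≤ 1 / (1 - θ) := fun n => by
      have hs : Summable (fun j : ℕ => θ ^ j) := summable_geometric_of_lt_one hθ0 hθ1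
      have h := hs.sum_le_tsum (range n) (fun j _ => pow_nonneg hθ0 j)
      rw [tsum_geometric_of_lt_one hθ0 hθ1] at h
      rw [one_div]; exact h
    calc ∑ i ∈ range K', (if k₀ ≤ i then q * (α * θ ^ i) else (0 : ℝ))
        ≤ ∑ i ∈ range (k₀ + K'), (if k₀ ≤ i then q * (α * θ ^ i) else 0) :=
          sum_le_sum_of_subset_of_nonneg (range_subset_range.mpr (Nat.le_add_left _ _)) fun i _ _ => by split_ifs <;> positivity
      _ = ∑ j ∈ range K', q * (α * θ ^ (k₀ + j)) := by
          rw [sum_range_add]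
          have hz : ∑ i ∈ range k₀, (if k₀ ≤ i then q * (α * θ ^ i) else (0 : ℝ)) = 0 :=
            sum_eq_zero fun i hi => if_neg (not_le.mpr (mem_range.mp hi))
          rw [hz, zero_add]
          exact sum_congr rfl fun j _ => if_pos (Nat.le_add_right _ _)
      _ = q * α * θ ^ k₀ * ∑ j ∈ range K', θ ^ j := by rw [mul_sum]; exact sum_congr rfl fun j _ => by rw [pow_add]; ring
      _ ≤ q * α * θ ^ k₀ * (1 / (1 - θ)) := mul_le_mul_of_nonneg_left (hgeom K') (by positivity)
      _ = q * α * (θ ^ k₀ / (1 - θ)) := by ring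
  calc _ ≤ _ := h1
    _ = (∑ i ∈ range K', if i < k₀ then p * β else 0) + ∑ i ∈ range K', (if k₀ ≤ i then q * (α * θ ^ i) else 0) := sum_add_distrib
    _ ≤ _ := add_le_add h2 h3

section Geom

variable {L : ℕ} [NeZero L] (M : Fin (d + 1) → ℕ) [∀ μ, NeZero (M μ)] (k m : ℕ) {F₂ : Type} [AddCommGroup F₂] [Module ℝ F₂]

/-- ★★ **THE SANDWICHED COEFFICIENT DEFECT, GEOMETRIC LEVEL LETTERS**: `K′` levels `T_i`; the `k₀` long-range ones (`i < k₀`) with source-divergence rows `≤ β·e^{−δd}`, the short-range ones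
(`k₀ ≤ i`) with plain rows `≤ α·θ^i·e^{−δd}` (`0 ≤ θ < 1`); `|c′| ≤ r`.  Then `(Σ_{i<K′} T_i)∘𝔇(M_{c′}, M_{blockAvg c′}) ≤ 2r·((d+1)·L^{−k}·β·k₀ + α·θ^{k₀}∕(1−θ))·e^{−δd}` — uniform in
`K′`; at `θ = L⁻¹`, `k₀ = k + 1` every summand carries `L^{−k}` and the level count enters as `k + 1` (the COARSE logarithm), not as `K′`.
[cite: Balaban1985BackgroundPropagators, (3.35) p.396 (sup letter only); King1986, (4.42) p.670 (the propagator as a sum over levels: shape)] -/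
theorem hasMaj_levels_comp_idef_mulOp_blockAvg_geom (K' k₀ : ℕ) {b₂ : BlockNorm (unitTorusGeo L k M) F₂}
    {T : ℕ → (Tor (fine (L ^ m * L ^ k) M) × Fin (d + 1) → ℝ) →ₗ[ℝ] F₂} {α β θ δ : ℝ} (hα : 0 ≤ α) (hβ : 0 ≤ β) (hθ0 : 0 ≤ θ) (hθ1 : θ < 1)
    (hTa : ∀ i, i < K' → k₀ ≤ i →
      HasMaj (BlockNorm.ofBlocks (unitTorusGeo L k M) (fun i : Tor (fine (L ^ m * L ^ k) M) × Fin (d + 1) => blockOf (L ^ m * L ^ k) M i.1)) b₂ (T i)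
        (fun y y' => α * θ ^ i * Real.exp (-(δ * tdistT M y y'))))
    (hTb : ∀ i, i < k₀ → ∀ κ : Fin (d + 1),
      HasMaj (BlockNorm.ofBlocks (unitTorusGeo L k M) (fun i : Tor (fine (L ^ m * L ^ k) M) × Fin (d + 1) => blockOf (L ^ m * L ^ k) M i.1)) b₂
        (T i ∘ₗ symbOp M (L ^ m * L ^ k) (((L ^ m * L ^ k : ℕ) : ℝ) • (sTinv M (L ^ m * L ^ k) κ - 1))) (fun y y' => β * Real.exp (-(δ * tdistT M y y'))))
    {c' : Tor (fine (L ^ m * L ^ k) M) × Fin (d + 1) → ℝ} {r : ℝ} (hr : 0 ≤ r) (hc' : ∀ z, |c' z| ≤ r) :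
    HasMaj (BlockNorm.ofBlocks (unitTorusGeo L k M) (blkFine L k M)) b₂
      ((∑ i ∈ range K', T i) ∘ₗ idef (pull (kingPrV L k m M)) (pull (kingPrV L k m M)) (mulOp c') (mulOp (blockAvg (kingPrV L k m M) c')))
      (fun y y' => 2 * r * ((d + 1) * (((L ^ k : ℕ) : ℝ))⁻¹ * β * k₀ + α * (θ ^ k₀ / (1 - θ))) * Real.exp (-(δ * tdistT M y y'))) := by
  have key := hasMaj_levels_comp_idef_mulOp_blockAvg M k m (range K') (fun i => i < k₀) (b₂ := b₂) (T := T)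
    (a := fun i y y' => α * θ ^ i * Real.exp (-(δ * tdistT M y y'))) (b := fun _ y y' => β * Real.exp (-(δ * tdistT M y y')))
    (fun _ _ _ => by positivity) (fun _ _ _ => by positivity) (fun i hi hb => hTa i (mem_range.mp hi) (not_lt.mp hb)) (fun i _ hb κ => hTb i hb κ) hr hc'
  refine key.mono fun y y' => ?_
  have hE : 0 ≤ Real.exp (-(δ * tdistT M y y')) := Real.exp_nonneg _
  have hn : (0 : ℝ) ≤ (((L ^ k : ℕ) : ℝ))⁻¹ := by positivity
  have hsum := geomLevels_sum_le (K' := K') (k₀ := k₀) (p := 2 * (d + 1) * r * (((L ^ k : ℕ) : ℝ))⁻¹) (q := 2 * r) (α := α) (β := β)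
    (by positivity) (by positivity) hα hβ hθ0 hθ1
  have heq : (∑ i ∈ range K', if i < k₀ then 2 * (d + 1) * r * (((L ^ k : ℕ) : ℝ))⁻¹ * (β * Real.exp (-(δ * tdistT M y y')))
      else 2 * r * (α * θ ^ i * Real.exp (-(δ * tdistT M y y')))) =
      (∑ i ∈ range K', if i < k₀ then 2 * (d + 1) * r * (((L ^ k : ℕ) : ℝ))⁻¹ * β else 2 * r * (α * θ ^ i)) * Real.exp (-(δ * tdistT M y y')) := by
    rw [sum_mul]
    exact sum_congr rfl fun i _ => by split_ifs <;> ring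
  calc (∑ i ∈ range K', if i < k₀ then 2 * (d + 1) * r * (((L ^ k : ℕ) : ℝ))⁻¹ * (β * Real.exp (-(δ * tdistT M y y')))
        else 2 * r * (α * θ ^ i * Real.exp (-(δ * tdistT M y y'))))
      = (∑ i ∈ range K', if i < k₀ then 2 * (d + 1) * r * (((L ^ k : ℕ) : ℝ))⁻¹ * β else 2 * r * (α * θ ^ i)) * Real.exp (-(δ * tdistT M y y')) := heq
    _ ≤ (2 * (d + 1) * r * (((L ^ k : ℕ) : ℝ))⁻¹ * β * k₀ + 2 * r * α * (θ ^ k₀ / (1 - θ))) * Real.exp (-(δ * tdistT M y y')) :=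
        mul_le_mul_of_nonneg_right hsum hE
    _ = _ := by ring

end Geom

end Summit.QuantumFields.YangMills.BalabanUVNodes.N15.TwoGrid

end
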